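import Mathlib
import Summits.PneNP.PneNP.Theorems.ClusUniversalCertificateCoordGauge

/-!
# Route ClusUniversalCertificate, crux `UniversalCertAll` — path `coord`: the gauge criterion for the COORDINATE step

Support file for `stmt-PneNP-19683` (cell pnp-ideate, route `ClusUniversalCertificate`, rung F-N1; path `coord` of pnp-ideate-p1,
skeleton v11 sha16 e5cba65d, COORDINATE disjunct of the peel conjecture `stub_peelZeroRare3`; objects of record
`ClusUniversalCertificateCoordDefs.lean` p516754, namespace `…Theorems.ClusCoord`).  Kernel form of p1's criterion
«the coordinate step in gauge form works iff `NL_ψ(Y) ≥ 2^{b−1}(W − Z)`» (lines/coord.md, proof architecture):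

Fix a coordinate `i` (block `k = blk i`) and a linear functional `φ` with `φ(e_i) = 1` (a GAUGE for the deleted direction).  Colour `Y` by
`φ`; the two colour classes, with coordinate `i` deleted, form the coordinate layer family `cgaugeFamily` (`isCLayerFamily_cgaugeFamily`:
a point is determined by `φ` and its other coordinates).  Inside a flat `A ∋ y` the colour class of `y` is `y + (A.direction ⊓ ker φ)`,
of codimension `≤ 1` in `A`, and deletion of coordinate `i` is injective on `ker φ`; so every point loses at most one dimension and the
NON-LOSING points — those with an optimal flat on which `φ` is constant (`NonLosing`) — lose nothing:
`dsum (M+1) Y ≤ Σ_{S} dsum M S + |Y| − #NonLosing_φ(Y)` (`dsum_le_cgaugeFamily`).  COROLLARY (`peelCoord_of_le_nonLosing`):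
`2^{bsize k − 1}·(W_i(Y) − Z_k(Y)) ≤ #NonLosing_φ(Y)` gives a coordinate layer family with the coordinate layer inequality `CLayerIneq` —
the coordinate disjunct of `stub_peelZeroRare3` for `(Y, i)` with the identity change of coordinates (a general deleted direction `v` of
block `k` is reduced to `e_i` by a block-zero-preserving automorphism, `ClusCoord.stub_inv`).
FRONTIER rung F-N1; a SUFFICIENT condition only — the conjecture and the crux are OPEN; nothing here bears on P vs NP.
-/

set_option linter.dupNamespace false -- `Summit.PneNP.PneNP.…`: summit = sub-problem name (D-0017 single-conjunct layout)

namespace Summit.PneNP.PneNP.Theorems.ClusCoordGaugeC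

open Finset
open Summit.PneNP.PneNP.Theorems.ClusCoord (acodim dsum bsize zcount wcount UCMix IsCLayerFamily CLayerIneq)
open Summit.PneNP.PneNP.Theorems.ClusCoordGauge (length_filter_toList)

variable {M n : ℕ}

/-! ## Deleting a coordinate, linearly -/

/-- Deleting coordinate `i` as a linear map (`= Fin.removeNth i`). -/
def delC (i : Fin (M + 1)) : (Fin (M + 1) → ZMod 2) →ₗ[ZMod 2] (Fin M → ZMod 2) :=
  LinearMap.funLeft (ZMod 2) (ZMod 2) (Fin.succAbove i)

/-- `delC i` is `Fin.removeNth i`. -/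
theorem delC_apply (i : Fin (M + 1)) (v : Fin (M + 1) → ZMod 2) : delC i v = Fin.removeNth i v := rfl

/-- A vector killed by a gauge `φ` (with `φ(e_i) = 1`) and by the deletion of coordinate `i` is zero. -/
theorem eq_zero_of_gauge_of_delC (i : Fin (M + 1)) (φ : Module.Dual (ZMod 2) (Fin (M + 1) → ZMod 2))
    (hφ : φ (Pi.single i 1) = 1) (v : Fin (M + 1) → ZMod 2) (h1 : φ v = 0) (h2 : delC i v = 0) : v = 0 := by
  have hv : v = v i • (Pi.single i (1 : ZMod 2) : Fin (M + 1) → ZMod 2) := by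
    funext l
    rcases Fin.eq_self_or_eq_succAbove i l with rfl | ⟨j, rfl⟩
    · simp
    · have := congrFun h2 j
      rw [delC_apply] at this
      have hz : v (i.succAbove j) = 0 := this
      rw [Pi.smul_apply, Pi.single_eq_of_ne (Fin.succAbove_ne i j), smul_zero, hz]
  have hvi : v i = 0 := by
    have := h1
    rw [hv, map_smul, hφ, smul_eq_mul, mul_one] at this
    exact this
  rw [hv, hvi, zero_smul]

/-! ## The coordinate gauge family -/

/-- The member of colour `c`: the points of `Y` with `φ = c`, coordinate `i` deleted. -/
noncomputable def cgaugeMember (Y : Finset (Fin (M + 1) → ZMod 2)) (i : Fin (M + 1))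
    (φ : Module.Dual (ZMod 2) (Fin (M + 1) → ZMod 2)) (c : ZMod 2) : Finset (Fin M → ZMod 2) :=
  (Y.filter fun y => φ y = c).image (delC i)

/-- The coordinate GAUGE FAMILY of `(Y, i, φ)`: the two colour classes, projected. -/
noncomputable def cgaugeFamily (Y : Finset (Fin (M + 1) → ZMod 2)) (i : Fin (M + 1))
    (φ : Module.Dual (ZMod 2) (Fin (M + 1) → ZMod 2)) : List (Finset (Fin M → ZMod 2)) :=
  (univ : Finset (ZMod 2)).toList.map (cgaugeMember Y i φ)

/-- Points with the same colour and the same other coordinates are equal. -/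
theorem eq_of_gauge_eq_of_delC_eq (i : Fin (M + 1)) (φ : Module.Dual (ZMod 2) (Fin (M + 1) → ZMod 2))
    (hφ : φ (Pi.single i 1) = 1) {y y' : Fin (M + 1) → ZMod 2} (hc : φ y = φ y') (hp : delC i y = delC i y') :
    y = y' := by
  have h1 : φ (y - y') = 0 := by rw [map_sub, hc, sub_self]
  have h2 : delC i (y - y') = 0 := by rw [map_sub, hp, sub_self]
  exact sub_eq_zero.mp (eq_zero_of_gauge_of_delC i φ hφ _ h1 h2)

/-- **The coordinate gauge family is a coordinate layer family.** -/
theorem isCLayerFamily_cgaugeFamily (Y : Finset (Fin (M + 1) → ZMod 2)) (i : Fin (M + 1))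
    (φ : Module.Dual (ZMod 2) (Fin (M + 1) → ZMod 2)) (hφ : φ (Pi.single i 1) = 1) :
    IsCLayerFamily Y i (cgaugeFamily Y i φ) := by
  intro x
  unfold cgaugeFamily
  rw [List.filter_map, List.length_map]
  have hlen : ((univ : Finset (ZMod 2)).toList.filter
      ((fun S : Finset (Fin M → ZMod 2) => decide (x ∈ S)) ∘ cgaugeMember Y i φ)).length =
      ((univ : Finset (ZMod 2)).filter fun c => x ∈ cgaugeMember Y i φ c).card := by
    rw [← length_filter_toList]
    rfl
  rw [hlen]
  have hset : ((univ : Finset (ZMod 2)).filter fun c => x ∈ cgaugeMember Y i φ c) =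
      (Y.filter fun y => Fin.removeNth i y = x).image φ := by
    ext c
    simp only [Finset.mem_filter, Finset.mem_univ, true_and, Finset.mem_image, cgaugeMember, delC_apply]
    constructor
    · rintro ⟨y, ⟨hy, hyc⟩, hyx⟩
      exact ⟨y, ⟨hy, hyx⟩, hyc⟩
    · rintro ⟨y, ⟨hy, hyx⟩, hyc⟩
      exact ⟨y, ⟨hy, hyc⟩, hyx⟩
  rw [hset, Finset.card_image_of_injOn]
  rintro y hy y' hy' hc
  have hyx := (Finset.mem_filter.1 (Finset.mem_coe.1 hy)).2
  have hy'x := (Finset.mem_filter.1 (Finset.mem_coe.1 hy')).2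
  exact eq_of_gauge_eq_of_delC_eq i φ hφ hc (by rw [delC_apply, delC_apply, hyx, hy'x])

/-! ## Loss at most one, none at the non-losing points -/

/-- **The member of `y` keeps `dim A − rank(φ | A.direction)` dimensions.** -/
theorem acodim_cmember_le (Y : Finset (Fin (M + 1) → ZMod 2)) (i : Fin (M + 1))
    (φ : Module.Dual (ZMod 2) (Fin (M + 1) → ZMod 2)) (hφ : φ (Pi.single i 1) = 1)
    (A : AffineSubspace (ZMod 2) (Fin (M + 1) → ZMod 2)) (y : Fin (M + 1) → ZMod 2) (hyA : y ∈ A) (hAY : ∀ z ∈ A, z ∈ Y) :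
    acodim M (cgaugeMember Y i φ (φ y)) (delC i y) + Module.finrank (ZMod 2) A.direction ≤
      M + Module.finrank (ZMod 2) (A.direction.map φ) := by
  set π := delC i with hπ
  set D := A.direction with hD
  set K : Submodule (ZMod 2) D := (LinearMap.ker φ).comap D.subtype with hK
  set E : Submodule (ZMod 2) (Fin M → ZMod 2) := K.map (π ∘ₗ D.subtype) with hE
  have hrn : Module.finrank (ZMod 2) (D.map φ) + Module.finrank (ZMod 2) K = Module.finrank (ZMod 2) D := by
    have := LinearMap.finrank_range_add_finrank_ker (φ.domRestrict D)
    rw [LinearMap.range_domRestrict, LinearMap.ker_domRestrict] at this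
    exact this
  have hinj : Function.Injective ((π ∘ₗ D.subtype) ∘ₗ K.subtype) := by
    rw [← LinearMap.ker_eq_bot, LinearMap.ker_eq_bot']
    intro d hd
    have hd0 : φ ((d : D) : Fin (M + 1) → ZMod 2) = 0 := LinearMap.mem_ker.mp (Submodule.mem_comap.mp d.2)
    have hπ0 : π ((d : D) : Fin (M + 1) → ZMod 2) = 0 := hd
    have := eq_zero_of_gauge_of_delC i φ hφ _ hd0 hπ0
    exact Subtype.ext (Subtype.ext this)
  have hEK : Module.finrank (ZMod 2) E = Module.finrank (ZMod 2) K := by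
    rw [hE, ← LinearMap.finrank_range_of_inj hinj, LinearMap.range_comp, Submodule.range_subtype]
  have hflat : acodim M (cgaugeMember Y i φ (φ y)) (π y) ≤ M - Module.finrank (ZMod 2) E := by
    unfold acodim
    apply Nat.sInf_le
    refine ⟨AffineSubspace.mk' (π y) E, AffineSubspace.self_mem_mk' _ _, ?_, ?_⟩
    · intro w hw
      rw [AffineSubspace.mem_mk', hE, Submodule.mem_map] at hw
      obtain ⟨d, hdK, hdw⟩ := hw
      have hd0 : φ ((d : D) : Fin (M + 1) → ZMod 2) = 0 := LinearMap.mem_ker.mp (Submodule.mem_comap.mp hdK)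
      have hzA : ((d : D) : Fin (M + 1) → ZMod 2) +ᵥ y ∈ A := AffineSubspace.vadd_mem_of_mem_direction d.2 hyA
      have hw' : w = π (((d : D) : Fin (M + 1) → ZMod 2) +ᵥ y) := by
        rw [vadd_eq_add, map_add]
        have : (π ∘ₗ D.subtype) d = w -ᵥ π y := hdw
        rw [LinearMap.comp_apply, Submodule.subtype_apply] at this
        rw [this, vsub_eq_sub, sub_add_cancel]
      rw [hw']
      unfold cgaugeMember
      apply Finset.mem_image_of_mem
      rw [Finset.mem_filter]
      refine ⟨hAY _ hzA, ?_⟩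
      rw [vadd_eq_add, map_add, hd0, zero_add]
    · rw [AffineSubspace.direction_mk']
      have : Module.finrank (ZMod 2) E ≤ M := by
        have := Submodule.finrank_le E
        rw [Module.finrank_fintype_fun_eq_card, Fintype.card_fin] at this
        exact this
      omega
  have hEle : Module.finrank (ZMod 2) E ≤ M := by
    have := Submodule.finrank_le E
    rw [Module.finrank_fintype_fun_eq_card, Fintype.card_fin] at this
    exact this
  rw [hEK] at hflat hEle
  omega

/-- The image of a subspace under a functional has dimension at most one. -/
theorem finrank_map_dual_le_one (φ : Module.Dual (ZMod 2) (Fin (M + 1) → ZMod 2))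
    (D : Submodule (ZMod 2) (Fin (M + 1) → ZMod 2)) : Module.finrank (ZMod 2) (D.map φ) ≤ 1 := by
  have := Submodule.finrank_le (D.map φ)
  rw [Module.finrank_self] at this
  exact this

/-- `y` is NON-LOSING for the gauge `φ`: some optimal flat through `y` inside `Y` lies in a level set of `φ`. -/
def NonLosing (Y : Finset (Fin (M + 1) → ZMod 2)) (φ : Module.Dual (ZMod 2) (Fin (M + 1) → ZMod 2))
    (y : Fin (M + 1) → ZMod 2) : Prop :=
  ∃ A : AffineSubspace (ZMod 2) (Fin (M + 1) → ZMod 2), y ∈ A ∧ (∀ z ∈ A, z ∈ Y) ∧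
    M + 1 ≤ Module.finrank (ZMod 2) A.direction + acodim (M + 1) Y y ∧ ∀ d ∈ A.direction, φ d = 0

/-- The sum of the members' `dsum` as a sum over the points of `Y`. -/
theorem sum_dsum_cgaugeFamily (Y : Finset (Fin (M + 1) → ZMod 2)) (i : Fin (M + 1))
    (φ : Module.Dual (ZMod 2) (Fin (M + 1) → ZMod 2)) (hφ : φ (Pi.single i 1) = 1) :
    ((cgaugeFamily Y i φ).map (dsum M)).sum =
      ∑ y ∈ Y, ((M : ℤ) - (acodim M (cgaugeMember Y i φ (φ y)) (delC i y) : ℤ)) := by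
  unfold cgaugeFamily
  rw [List.map_map, Finset.sum_map_toList]
  have hmem : ∀ c : ZMod 2, dsum M (cgaugeMember Y i φ c) =
      ∑ y ∈ Y.filter (fun y => φ y = c), ((M : ℤ) - (acodim M (cgaugeMember Y i φ (φ y)) (delC i y) : ℤ)) := by
    intro c
    unfold dsum
    unfold cgaugeMember
    rw [Finset.sum_image]
    · refine Finset.sum_congr rfl fun y hy => ?_
      rw [(Finset.mem_filter.1 hy).2]
    · intro y hy y' hy' hp
      exact eq_of_gauge_eq_of_delC_eq i φ hφ
        ((Finset.mem_filter.1 (Finset.mem_coe.1 hy)).2.trans (Finset.mem_filter.1 (Finset.mem_coe.1 hy')).2.symm) hp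
  simp only [Function.comp_def, hmem]
  exact Finset.sum_fiberwise_of_maps_to (s := Y) (t := univ) (g := fun y => φ y) (fun y _ => Finset.mem_univ _) _

open scoped Classical in
/-- **Loss at most one per point, none at non-losing points**: `dsum (M+1) Y + #NonLosing_φ(Y) ≤ Σ_S dsum M S + |Y|`. -/
theorem dsum_le_cgaugeFamily (Y : Finset (Fin (M + 1) → ZMod 2)) (i : Fin (M + 1))
    (φ : Module.Dual (ZMod 2) (Fin (M + 1) → ZMod 2)) (hφ : φ (Pi.single i 1) = 1) :
    dsum (M + 1) Y + ((Y.filter (NonLosing Y φ)).card : ℤ) ≤ ((cgaugeFamily Y i φ).map (dsum M)).sum + (Y.card : ℤ) := by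
  rw [sum_dsum_cgaugeFamily Y i φ hφ]
  unfold dsum
  have hpt : ∀ y ∈ Y, (((M + 1 : ℕ) : ℤ) - (acodim (M + 1) Y y : ℤ)) + (if NonLosing Y φ y then (1 : ℤ) else 0) ≤
      ((M : ℤ) - (acodim M (cgaugeMember Y i φ (φ y)) (delC i y) : ℤ)) + 1 := by
    intro y hy
    by_cases hnl : NonLosing Y φ y
    · rw [if_pos hnl]
      obtain ⟨A, hyA, hAY, hopt, hconst⟩ := hnl
      have h1 := acodim_cmember_le Y i φ hφ A y hyA hAY
      have h0 : Module.finrank (ZMod 2) (A.direction.map φ) = 0 := by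
        rw [Submodule.finrank_eq_zero, Submodule.eq_bot_iff]
        rintro x ⟨d, hd, rfl⟩
        exact hconst d hd
      rw [h0, add_zero] at h1
      have h1' : (acodim M (cgaugeMember Y i φ (φ y)) (delC i y) : ℤ) + (Module.finrank (ZMod 2) A.direction : ℤ) ≤ (M : ℤ) := by
        exact_mod_cast h1
      have hopt' : ((M + 1 : ℕ) : ℤ) ≤ (Module.finrank (ZMod 2) A.direction : ℤ) + (acodim (M + 1) Y y : ℤ) := by
        exact_mod_cast hopt
      linarith
    · rw [if_neg hnl, add_zero]
      obtain ⟨A, hyA, hAY, hopt⟩ := ClusCoordGauge.exists_optimal Y y hy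
      have h1 := acodim_cmember_le Y i φ hφ A y hyA hAY
      have h2 := finrank_map_dual_le_one φ A.direction
      have h1' : (acodim M (cgaugeMember Y i φ (φ y)) (delC i y) : ℤ) + (Module.finrank (ZMod 2) A.direction : ℤ) ≤
          (M : ℤ) + (Module.finrank (ZMod 2) (A.direction.map φ) : ℤ) := by exact_mod_cast h1
      have h2' : (Module.finrank (ZMod 2) (A.direction.map φ) : ℤ) ≤ 1 := by exact_mod_cast h2
      have hopt' : ((M + 1 : ℕ) : ℤ) ≤ (Module.finrank (ZMod 2) A.direction : ℤ) + (acodim (M + 1) Y y : ℤ) := by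
        exact_mod_cast hopt
      linarith
  have hsum := Finset.sum_le_sum hpt
  rw [Finset.sum_add_distrib, Finset.sum_add_distrib, Finset.sum_boole, Finset.sum_const, nsmul_eq_mul, mul_one] at hsum
  linarith

open scoped Classical in
/-- **The coordinate disjunct of the peel conjecture from a gauge with many non-losing points**:
if `2^{bsize k − 1}·(W_i(Y) − Z_k(Y)) ≤ #NonLosing_φ(Y)` (`k = blk i`), the coordinate gauge family satisfies the coordinate layer
inequality `CLayerIneq`. -/
theorem peelCoord_of_le_nonLosing (blk : Fin (M + 1) → Fin n) (Y : Finset (Fin (M + 1) → ZMod 2)) (i : Fin (M + 1))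
    (φ : Module.Dual (ZMod 2) (Fin (M + 1) → ZMod 2)) (hφ : φ (Pi.single i 1) = 1)
    (hNL : (2 : ℤ) ^ (bsize blk (blk i) - 1) * ((wcount blk i Y : ℤ) - (zcount blk (blk i) Y : ℤ)) ≤
      ((Y.filter (NonLosing Y φ)).card : ℤ)) :
    ∃ L : List (Finset (Fin M → ZMod 2)), IsCLayerFamily Y i L ∧ CLayerIneq M n blk Y i L := by
  refine ⟨cgaugeFamily Y i φ, isCLayerFamily_cgaugeFamily Y i φ hφ, ?_⟩
  unfold CLayerIneq
  have h := dsum_le_cgaugeFamily Y i φ hφ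
  have : (2 : ℤ) ^ (bsize blk (blk i) - 1) * ((zcount blk (blk i) Y : ℤ) - (wcount blk i Y : ℤ)) =
      -((2 : ℤ) ^ (bsize blk (blk i) - 1) * ((wcount blk i Y : ℤ) - (zcount blk (blk i) Y : ℤ))) := by ring
  rw [this]
  linarith

end Summit.PneNP.PneNP.Theorems.ClusCoordGaugeC
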